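import Literature.AnabelianGeometry.SemiGraphs.PSCThm16iiLevelPackages
import Literature.AnabelianGeometry.SemiGraphs.PSCLevelwiseCofinal
import Literature.AnabelianGeometry.SemiGraphs.PSCCoveringDatumSturdyAt
import Literature.AnabelianGeometry.SemiGraphs.PSCGraphicityEasyDirections
import HarnessLib

/-!
# [CombGC] Theorem 1.6 (ii), ASSEMBLED: graphic ⟺ graphically filtration-preserving (at `Σ = {l}`)

Mochizuki, *A combinatorial version of the Grothendieck conjecture*, Tohoku Math. J. **59** (2007)
[CombGC], Theorem 1.6 (ii), author's manuscript p. 13 ("`α` is graphic if and only if it is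
graphically filtration-preserving"), proof p. 14 (with the amendments [IUTchI] Rmk. 1.2.3 (v)(vii)).
WRITER'S FINAL COMPOSITION of the cell's sub-DAG for Thm. 1.6 (`plan/L3/SUBDAG-CombGC-Thm16.md`,
row T16-L00 (ii); route 2 of the §ASSEMBLY SPEC): for data of `Ω`-type on profinite groups with
`Σ_G = Σ_H = {l}` and a graphically filtration-preserving `α : Π_G ⥲ Π_H` —

(A) a common open normal level `U₀` below which all covering data `G_U`, `H_{α U}` are STURDY
(Rmk. 1.1.5: `SturdyCoverHolds`, read on the covering data by abc-iut-L3-t4's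
`isSturdyAt_restrictBD_top_iff`); (C) `α` is group-theoretically cuspidal: Thm. 1.6 (i) at the sturdy
level `U₀` (rows T16-L08/L01/L03) descended by Prop. 1.2 (ii) (`isGroupTheoreticallyCuspidal_of_restrictBD`,
abc-iut-w4-d052); (E) at every level `U ≤ U₀` the node package (`node_package_of_holds`: compactify,
[IUTchI] Rmk. 1.2.3 (v), node existence derived) — whence by abc-iut-w5-d188's cofinal level-wise descent
`nodal_transport_of_graphic_mod_le` and `isGroupTheoreticallyEdgeLike_of_nodal_of_cuspidal` the
isomorphism `α` is group-theoretically EDGE-LIKE; (V) at every level `U ≤ U₀` the vertex package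
(`vertex_package_of_holds`: `β_U`, Thm. 1.6 (iii) assembled) — whence by
`isGroupTheoreticallyVerticial_of_graphic_mod_le` the isomorphism `α` is group-theoretically VERTICIAL;
(H) Prop. 1.5 (ii) (`GraphicIffEdgeLikeVerticialHolds`): `α` is GRAPHIC.

* `isGraphic_of_isGraphicallyFiltrationPreserving_holds` — Thm. 1.6 (ii) ⇐;
* `graphicIffFiltrationPreserving_holds_of_inputs` — the typed statement
  `GraphicIffGraphicallyFiltrationPreserving` (⇒ is abc-iut-L5-t6's `isGraphicallyFiltrationPreserving_of_isGraphic`).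

Inputs, all BY NAME (origin statements `…Holds Ω` of the interface and of the sub-DAG's statements
files): `RankStatementsHold`, `CuspidalEdgeLikeCharacterizationHolds`, `NodalEdgeLikeCharacterizationHolds`,
`CompactifyOfPSCTypeHolds`, `RestrictBDOfPSCTypeHolds`, `SturdyCoverHolds`, `OpenInterDeterminesComponentHolds`,
`CommensurableTerminalityHolds`, `GraphicIffEdgeLikeVerticialHolds`, `UnrVerticialCharacterizationHolds`,
`UnrVertAbOfRankHolds`, `VertCountLeNodeCountSuccHolds`; profiniteness of the groups (`hprof`); and
`Σ = {l}` (the general-`Σ` reduction "we may assume `Σ = {l}`" is row T16-L04, abc-iut-w5-d183).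
Proof-only (0 defs); nothing here takes a side on [IUTchIII] Cor. 3.12.
[cite: MochizukiCombGC2007, Thm 1.6(ii) p.13] [cite: MochizukiCombGC2007, Thm 1.6(ii) p.14]
-/

noncomputable section

namespace Literature.AnabelianGeometry.SemiGraphs

namespace PSCDatum

open PSCCovering
open scoped Pointwise

universe u

variable (Ω : PSCOrigin.{u})

/-- **[CombGC] Theorem 1.6 (ii) ⇐, ASSEMBLED** (for data of `Ω`-type on profinite groups with
`Σ_G = Σ_H = {l}`): a graphically filtration-preserving `α : Π_G ⥲ Π_H` is graphic — every input an
origin statement BY NAME (see the module docstring), composed along the printed proof (p. 14) with the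
amendments [IUTchI] Rmk. 1.2.3 (v)(vii). [cite: MochizukiCombGC2007, Thm 1.6(ii) p.14] -/
theorem isGraphic_of_isGraphicallyFiltrationPreserving_holds
    (hprof : ∀ ⦃Q : Type u⦄ [Group Q] [TopologicalSpace Q] [IsTopologicalGroup Q] (K : PSCDatum Q),
      Ω.IsOfPSCType K → CompactSpace Q ∧ TotallyDisconnectedSpace Q)
    (hrank : RankStatementsHold Ω) (hcuspΩ : CuspidalEdgeLikeCharacterizationHolds Ω)
    (hnodal : NodalEdgeLikeCharacterizationHolds Ω) (hcpt : CompactifyOfPSCTypeHolds Ω)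
    (hres : RestrictBDOfPSCTypeHolds Ω) (hcover : SturdyCoverHolds Ω)
    (hopen : OpenInterDeterminesComponentHolds Ω) (hCT : CommensurableTerminalityHolds Ω)
    (hP15 : GraphicIffEdgeLikeVerticialHolds Ω) (hunr : UnrVerticialCharacterizationHolds Ω)
    (hrankv : UnrVertAbOfRankHolds Ω) (hconn : VertCountLeNodeCountSuccHolds Ω)
    ⦃R : Type u⦄ [Group R] [TopologicalSpace R] [IsTopologicalGroup R]
    ⦃R' : Type u⦄ [Group R'] [TopologicalSpace R'] [IsTopologicalGroup R']
    {G : PSCDatum R} {H : PSCDatum R'} {α : R ≃ₜ* R'} (hGΩ : Ω.IsOfPSCType G) (hHΩ : Ω.IsOfPSCType H)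
    {l : ℕ} (hS : G.Sigma = {l}) (hS' : H.Sigma = {l}) (hα : G.IsGraphicallyFiltrationPreserving H α) :
    G.IsGraphic H α := by
  obtain ⟨hcR, htR⟩ := hprof G hGΩ
  obtain ⟨hcR', htR'⟩ := hprof H hHΩ
  haveI := hcR; haveI := htR; haveI := hcR'; haveI := htR'
  -- branch data with coverings of `Ω`-type
  obtain ⟨bd, hbd⟩ := hres G hGΩ
  obtain ⟨bd', hbd'⟩ := hres H hHΩ
  -- (A) sturdy characteristic levels `H₀ ≤ Π_G`, `H₀' ≤ Π_H`, and `U₀ := H₀ ⊓ α⁻¹ H₀'`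
  obtain ⟨H₀, hH₀o, hH₀c, hH₀s⟩ := (hcover G hGΩ).2
  obtain ⟨H₀', hH₀'o, hH₀'c, hH₀'s⟩ := (hcover H hHΩ).2
  haveI := hH₀c
  haveI := hH₀'c
  set U₀ : Subgroup R := H₀ ⊓ H₀'.comap α.toMulEquiv.toMonoidHom with hU₀def
  have hU₀o : IsOpen (U₀ : Set R) := by
    rw [hU₀def, Subgroup.coe_inf, Subgroup.coe_comap]
    exact hH₀o.inter (hH₀'o.preimage α.continuous)
  haveI hU₀n : U₀.Normal := Subgroup.normal_inf_normal H₀ (H₀'.comap α.toMulEquiv.toMonoidHom)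
  -- sturdiness of the covering data at the levels `U ≤ U₀`
  have hGUs : ∀ (U : Subgroup R) [U.FiniteIndex] (hU : IsOpen (U : Set R)), U ≤ U₀ →
      (G.restrictBD U hU bd).IsSturdy := fun U _ hU hle =>
    ((hcover _ (hbd U hU)).1).mp
      ((G.isSturdyAt_restrictBD_top_iff U hU bd).mpr (hH₀s U hU (hle.trans inf_le_left)))
  have hHUs : ∀ (U : Subgroup R) [U.FiniteIndex] (hU : IsOpen (U : Set R))
      [(U.map α.toMulEquiv.toMonoidHom).FiniteIndex]
      (hU' : IsOpen ((U.map α.toMulEquiv.toMonoidHom : Subgroup R') : Set R')), U ≤ U₀ →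
      (H.restrictBD (U.map α.toMulEquiv.toMonoidHom) hU' bd').IsSturdy := fun U _ hU _ hU' hle => by
    have hle' : U.map α.toMulEquiv.toMonoidHom ≤ H₀' := by
      rintro _ ⟨x, hx, rfl⟩
      exact (inf_le_right : U₀ ≤ H₀'.comap α.toMulEquiv.toMonoidHom) (hle hx)
    exact ((hcover _ (hbd' _ hU')).1).mp
      ((H.isSturdyAt_restrictBD_top_iff _ hU' bd').mpr (hH₀'s _ hU' hle'))
  -- level bookkeeping: `α U` is open normal of finite index
  have hlev : ∀ (U : Subgroup R), U.Normal → IsOpen (U : Set R) →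
      (U.map α.toMulEquiv.toMonoidHom).Normal ∧
        IsOpen ((U.map α.toMulEquiv.toMonoidHom : Subgroup R') : Set R') := fun U hUn hUo =>
    ⟨hUn.map _ α.surjective, by rw [Subgroup.coe_map]; exact α.toHomeomorph.isOpenMap _ hUo⟩
  -- (C) `α` is group-theoretically cuspidal: Thm. 1.6 (i) at the sturdy level `U₀`, descended
  haveI hU₀f : U₀.FiniteIndex := finiteIndex_of_isOpen U₀ hU₀o
  obtain ⟨hU₀'n, hU₀'o⟩ := hlev U₀ hU₀n hU₀o
  haveI := hU₀'n
  haveI : (U₀.map α.toMulEquiv.toMonoidHom).FiniteIndex := finiteIndex_of_isOpen _ hU₀'o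
  have hcusp : G.IsGroupTheoreticallyCuspidal H α :=
    G.isGroupTheoreticallyCuspidal_of_restrictBD H α hU₀o hU₀'o rfl bd bd' (hCT G hGΩ).1 (hCT H hHΩ).1
      (restrictBD_isGroupTheoreticallyCuspidal_of_holds Ω hrank hcuspΩ hS hS' hα U₀ hU₀o hU₀'o
        (hbd U₀ hU₀o) (hbd' _ hU₀'o) (hGUs U₀ hU₀o le_rfl) (hHUs U₀ hU₀o hU₀'o le_rfl))
  -- (E) `α` is group-theoretically edge-like: node packages at every level `U ≤ U₀`
  have hnod := nodal_transport_of_graphic_mod_le α G H hU₀n hU₀o fun U hUn hUo hle => by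
    haveI := hUn
    haveI : U.FiniteIndex := finiteIndex_of_isOpen U hUo
    obtain ⟨hU'n, hU'o⟩ := hlev U hUn hUo
    haveI := hU'n
    haveI : (U.map α.toMulEquiv.toMonoidHom).FiniteIndex := finiteIndex_of_isOpen _ hU'o
    exact node_package_of_holds Ω hrank hcuspΩ hnodal hcpt hopen hunr hrankv hconn hS hS' hα U hUo hU'o
      (hbd U hUo) (hbd' _ hU'o) (hGUs U hUo hle) (hHUs U hUo hU'o hle)
  have hedge : G.IsGroupTheoreticallyEdgeLike H α :=
    isGroupTheoreticallyEdgeLike_of_nodal_of_cuspidal hnod.1 hnod.2 hcusp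
  -- (V) `α` is group-theoretically verticial: vertex packages at every level `U ≤ U₀`
  have hvert : G.IsGroupTheoreticallyVerticial H α :=
    isGroupTheoreticallyVerticial_of_graphic_mod_le α G H hU₀n hU₀o fun U hUn hUo hle => by
      haveI := hUn
      haveI : U.FiniteIndex := finiteIndex_of_isOpen U hUo
      obtain ⟨hU'n, hU'o⟩ := hlev U hUn hUo
      haveI := hU'n
      haveI : (U.map α.toMulEquiv.toMonoidHom).FiniteIndex := finiteIndex_of_isOpen _ hU'o
      exact vertex_package_of_holds Ω hprof hrank hopen hunr hrankv hconn hres hS hS' hα hedge U hUo hU'o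
        (hbd U hUo) (hbd' _ hU'o) (hGUs U hUo hle) (hHUs U hUo hU'o hle)
  -- (H) Prop. 1.5 (ii)
  exact (hP15 G H α hGΩ hHΩ).1.mpr ⟨hedge, hvert⟩

/-- **[CombGC] Theorem 1.6 (ii) as typed (`GraphicIffGraphicallyFiltrationPreserving`)**, for all data
of `Ω`-type on profinite groups with `Σ_G = Σ_H = {l}` and every `α : Π_G ⥲ Π_H`: "`α` is graphic if
and only if it is graphically filtration-preserving" — necessity by abc-iut-L5-t6's
`isGraphicallyFiltrationPreserving_of_isGraphic`, sufficiency by the composition above; inputs BY NAME.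
[cite: MochizukiCombGC2007, Thm 1.6(ii) p.13] -/
theorem graphicIffFiltrationPreserving_holds_of_inputs
    (hprof : ∀ ⦃Q : Type u⦄ [Group Q] [TopologicalSpace Q] [IsTopologicalGroup Q] (K : PSCDatum Q),
      Ω.IsOfPSCType K → CompactSpace Q ∧ TotallyDisconnectedSpace Q)
    (hrank : RankStatementsHold Ω) (hcuspΩ : CuspidalEdgeLikeCharacterizationHolds Ω)
    (hnodal : NodalEdgeLikeCharacterizationHolds Ω) (hcpt : CompactifyOfPSCTypeHolds Ω)
    (hres : RestrictBDOfPSCTypeHolds Ω) (hcover : SturdyCoverHolds Ω)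
    (hopen : OpenInterDeterminesComponentHolds Ω) (hCT : CommensurableTerminalityHolds Ω)
    (hP15 : GraphicIffEdgeLikeVerticialHolds Ω) (hunr : UnrVerticialCharacterizationHolds Ω)
    (hrankv : UnrVertAbOfRankHolds Ω) (hconn : VertCountLeNodeCountSuccHolds Ω)
    ⦃R : Type u⦄ [Group R] [TopologicalSpace R] [IsTopologicalGroup R]
    ⦃R' : Type u⦄ [Group R'] [TopologicalSpace R'] [IsTopologicalGroup R']
    {G : PSCDatum R} {H : PSCDatum R'} (hGΩ : Ω.IsOfPSCType G) (hHΩ : Ω.IsOfPSCType H)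
    {l : ℕ} (hS : G.Sigma = {l}) (hS' : H.Sigma = {l}) (α : R ≃ₜ* R') :
    G.GraphicIffGraphicallyFiltrationPreserving H α :=
  ⟨G.isGraphicallyFiltrationPreserving_of_isGraphic H α,
    isGraphic_of_isGraphicallyFiltrationPreserving_holds Ω hprof hrank hcuspΩ hnodal hcpt hres hcover hopen
      hCT hP15 hunr hrankv hconn hGΩ hHΩ hS hS'⟩

end PSCDatum

end Literature.AnabelianGeometry.SemiGraphs

end
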